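import Mathlib
import HarnessLib
import Literature.Analysis.FluidPDE.SuitableWeak
import Literature.Analysis.FluidPDE.SelfSimilar
import Literature.Analysis.FluidPDE.LocalTypeI
import Literature.Analysis.FluidPDE.NSBoundedMildOseen
import Summits.NavierStokesRegularity.NavierStokesRegularity.Theses.RellichScar

/-!
# Skeleton — line `decaying-ancient-bridge` for crux `RellichScar.ApexLocalisation`
(stmt-NavierStokesRegularity-11719; lead prover-line-stmt-NavierStokesRegularity-11719-0)

Composition `ApexLocalisation_of` of six registered stubs (sorries only in `stub_*`):

* `stub_slabCompactness`  — ENGINE (A–B Lemma 2.2 + Prop 2.3 exhausted to the slab): suitable weak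
  solutions on the slab with uniformly bounded Albritton–Barker quantity `𝐈 ≤ I < ⊤` subconverge in
  `L³(Q(0,R))` for every `R` to a suitable weak solution on the slab with `𝐈 ≤ 4I`, singular at the
  origin if the approximants blow up in `L^∞(Q(0,R))` for every `R`.
* `stub_rateToAncient`    — ⇒ TRANSFER (A–B Thm 1.1 forward direction WITH the rate): a rate-Type-I
  singular slab profile yields a non-trivial bounded continuous Oseen-mild ancient solution with the
  rate and suitable-weak data with `𝐈 < ⊤` (the class 𝒜(C,B) below, inlined).
* `stub_radiationBound`   — UNCONDITIONAL near-field radiation bound: for a bounded continuous field with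
  the Morrey bound `∫_{B_r(z)} |M(τ)|² ≤ I r`, the Oseen–Duhamel contribution of sources at distance
  `≥ ‖x‖/2` from `x` is `≤ c₀ I / ‖x‖`, uniformly in the initial time.
* `stub_hullSelection`    — THE BET (symmetry-free KNSS (1.4) ⇒ (1.6), Seregin 2014 Prop 5.19 without
  axisymmetry): some translation/zoom-in hull limit `N` of a class member is continuous, non-trivial
  and obeys `‖y‖ ‖N(s,y)‖ ≤ K`.
* `stub_hullClosed`       — the class 𝒜(C,B) is closed under translation/zoom-in hull limits.
* `stub_apexOfDecaying`   — ⇐ TRANSFER (`DecayingAncientGivesApex`): a non-trivial suitable weak slab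
  solution with `𝐈 < ⊤` and the shifted decay `C'/(1+‖x‖+√−t)` blows DOWN to an apex profile.

Glue proved here: `shiftedDecay_of_bounds`, `not_ae_eq_zero_of_continuousOn`, `ApexLocalisation_of`.

The class 𝒜(C,B) of a field `M : ℝ → E³ → E³` ("bounded decaying ancient solution"), INLINED in every
signature (no new definitions): `ContinuousOn (uncurry M) (Iio 0 ×ˢ univ)`, weakly divergence-free
slices, the Oseen integral identity `M t x = heatExtension (M s) (t-s) x - oseenDuhamel 1 s M M t x`
for all `s < t < 0` (KNSS gauge, as output by the tree's `KNSS2009_typeI_rate_mildCompactness_holds`),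
`‖M t x‖ ≤ B`, `HasTypeITimeDecay C M`, and `∃ q H`, suitable weak on the slab with weak gradient `H`
and `typeIBound (Iio 0 ×ˢ univ) M q H < ⊤`.
-/

-- the summit and its single sub-problem share the name (CONVENTIONS §1), as in every Theorems file
set_option linter.dupNamespace false

namespace Summit.NavierStokesRegularity.NavierStokesRegularity.Theorems.RellichScarApexLocalisation

open MeasureTheory Set Function Metric Filter Topology TopologicalSpace
open scoped ENNReal NNReal
open Literature.Analysis Literature.Analysis.FluidPDE

local notation "E³" => EuclideanSpace ℝ (Fin 3)

/-! ### Stub 0 — the engine: slab-level suitable compactness with lsc of 𝐈 and persistence -/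

/-- ENGINE. Albritton–Barker 2019 Lemma 2.2 (Lin 1998 compactness) and Prop. 2.3 (persistence of
singularities), exhausted from the unit ball to the whole slab `(-∞,0) × ℝ³` along the balls `Q(0,R)`:
uniform `𝐈 ≤ I < ⊤` gives uniform `L³`/mean-free-`L^{3/2}` bounds on every `Q(0,R)`; diagonal
extraction; gluing of the limits (pressures up to time gauges); lsc of `A, C, D, E` separately (whence
`4 I`); persistence on every ball. Tools: `SuitableCompactness_holds`, `PersistenceOfSingularities_holds`,
`isSuitableWeakSolutionInBall_zoom`, `IsSuitableWeakSolutionOn.of_exhaustion`, `LocalTypeILsc*`. -/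
theorem stub_slabCompactness :
    ∀ (I : ℝ≥0∞) (v : ℕ → ℝ → E³ → E³) (q : ℕ → ℝ → E³ → ℝ) (G : ℕ → ℝ → E³ → E³ →L[ℝ] E³),
      I < ⊤ →
      (∀ k, IsSuitableWeakSolutionOn (slab E³ (Iio 0) isOpen_Iio) 1 0 (v k) (q k)) →
      (∀ k, HasWeakSpatialGradientOn (slab E³ (Iio 0) isOpen_Iio) (v k) (G k)) →
      (∀ k, typeIBound (Iio (0 : ℝ) ×ˢ univ) (v k) (q k) (G k) ≤ I) →
      ∃ (u : ℝ → E³ → E³) (p : ℝ → E³ → ℝ) (H : ℝ → E³ → E³ →L[ℝ] E³) (σ : ℕ → ℕ),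
        StrictMono σ ∧
        IsSuitableWeakSolutionOn (slab E³ (Iio 0) isOpen_Iio) 1 0 u p ∧
        HasWeakSpatialGradientOn (slab E³ (Iio 0) isOpen_Iio) u H ∧
        typeIBound (Iio (0 : ℝ) ×ˢ univ) u p H ≤ 4 * I ∧
        (∀ R : ℝ, 0 < R → Tendsto (fun j => eLpNorm (uncurry (v (σ j)) - uncurry u) 3
          (volume.restrict (parabolicCylinder R (0 : ℝ × E³)))) atTop (𝓝 0)) ∧
        ((∀ R : ℝ, 0 < R → limsup (fun j => eLpNorm (uncurry (v (σ j))) ⊤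
            (volume.restrict (parabolicCylinder R (0 : ℝ × E³)))) atTop = ⊤) →
          IsBackwardSingularPoint u 0) := by
  sorry

/-! ### Stub 1 — the ⇒ transfer: rate-Type-I singular profile ⇒ bounded decaying ancient solution -/

/-- ⇒ TRANSFER (Albritton–Barker 2019 Thm 1.1 forward direction / Seregin–Šverák 2009 Thm 2.8, WITH
the rate inherited, KNSS 2009 §6): from a rate-Type-I slab profile singular at the origin, rescale at
near-maximum points `(t_k, x_k)`, `λ_k = 1/M_k`, `M_k = sup_{t ≤ t_k} |u| → ∞`; the rescaled fields
are bounded by `1`, keep the rate with the SAME `C` (`σ_k = -t_k M_k² ≤ 4C²`), are Oseen-mild on their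
slabs (bounded suitable weak + `𝐈 < ∞` ⇒ mild, KNSS), and subconverge locally uniformly
(`KNSS2009_typeI_rate_mildCompactness_holds` engine) to a continuous Oseen-mild `M` with the rate,
bounded, non-trivial near the vertex (KNSS vertex estimate); the engine `stub_slabCompactness` run on
the same rescaled suitable triples supplies `q, H` with `𝐈 < ⊤` for (an a.e.-equal field, hence for) `M`. -/
theorem stub_rateToAncient :
    (∀ (I : ℝ≥0∞) (v : ℕ → ℝ → E³ → E³) (q : ℕ → ℝ → E³ → ℝ) (G : ℕ → ℝ → E³ → E³ →L[ℝ] E³),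
      I < ⊤ →
      (∀ k, IsSuitableWeakSolutionOn (slab E³ (Iio 0) isOpen_Iio) 1 0 (v k) (q k)) →
      (∀ k, HasWeakSpatialGradientOn (slab E³ (Iio 0) isOpen_Iio) (v k) (G k)) →
      (∀ k, typeIBound (Iio (0 : ℝ) ×ˢ univ) (v k) (q k) (G k) ≤ I) →
      ∃ (u : ℝ → E³ → E³) (p : ℝ → E³ → ℝ) (H : ℝ → E³ → E³ →L[ℝ] E³) (σ : ℕ → ℕ),
        StrictMono σ ∧
        IsSuitableWeakSolutionOn (slab E³ (Iio 0) isOpen_Iio) 1 0 u p ∧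
        HasWeakSpatialGradientOn (slab E³ (Iio 0) isOpen_Iio) u H ∧
        typeIBound (Iio (0 : ℝ) ×ˢ univ) u p H ≤ 4 * I ∧
        (∀ R : ℝ, 0 < R → Tendsto (fun j => eLpNorm (uncurry (v (σ j)) - uncurry u) 3
          (volume.restrict (parabolicCylinder R (0 : ℝ × E³)))) atTop (𝓝 0)) ∧
        ((∀ R : ℝ, 0 < R → limsup (fun j => eLpNorm (uncurry (v (σ j))) ⊤
            (volume.restrict (parabolicCylinder R (0 : ℝ × E³)))) atTop = ⊤) →
          IsBackwardSingularPoint u 0)) →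
    ∀ C : ℝ,
      (∃ (u : ℝ → E³ → E³) (p : ℝ → E³ → ℝ) (G : ℝ → E³ → E³ →L[ℝ] E³),
        IsSuitableWeakSolutionOn (slab E³ (Iio 0) isOpen_Iio) 1 0 u p ∧
        HasWeakSpatialGradientOn (slab E³ (Iio 0) isOpen_Iio) u G ∧
        typeIBound (Iio (0 : ℝ) ×ˢ univ) u p G < ⊤ ∧ HasTypeITimeDecay C u ∧
        IsBackwardSingularPoint u 0) →
      ∃ (B : ℝ) (M : ℝ → E³ → E³),
        (ContinuousOn (uncurry M) (Iio (0 : ℝ) ×ˢ univ) ∧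
          (∀ t < 0, IsWeaklyDivFree (M t)) ∧
          (∀ s t : ℝ, s < t → t < 0 → ∀ x : E³,
            M t x = UnboundedOperators.heatExtension (M s) (t - s) x - oseenDuhamel 1 s M M t x) ∧
          (∀ t < 0, ∀ x : E³, ‖M t x‖ ≤ B) ∧
          HasTypeITimeDecay C M ∧
          (∃ (q : ℝ → E³ → ℝ) (H : ℝ → E³ → E³ →L[ℝ] E³),
            IsSuitableWeakSolutionOn (slab E³ (Iio 0) isOpen_Iio) 1 0 M q ∧
            HasWeakSpatialGradientOn (slab E³ (Iio 0) isOpen_Iio) M H ∧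
            typeIBound (Iio (0 : ℝ) ×ˢ univ) M q H < ⊤)) ∧
        (∃ s : ℝ, s < 0 ∧ ∃ y : E³, M s y ≠ 0) := by
  sorry

/-! ### Stub 2 — the unconditional near-field radiation bound -/

/-- RADIATION BOUND (the card's `NearFieldRadiationBound`, symmetry-free substitute for the
Γ-maximum principle): there is a universal `c₀` such that for every bounded field `M`, continuous on
the slab, with the scale-invariant Morrey bound `∫_{B_r(z)} ‖M(τ,y)‖² dy ≤ I r` (all `τ < 0`, `z`,
`r > 0`; for class members this is `A ≤ 𝐈`), the Oseen–Duhamel contribution at `(t,x)`, `x ≠ 0`, of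
the sources at distance `≥ ‖x‖/2` from `x` over ANY time window `(s,t)` is at most `c₀ I / ‖x‖`:
dyadic shells `‖y - x‖ ~ 2^k ‖x‖/2 =: r_k`, kernel bound `‖K(θ,ζ)[a,a]‖ ≲ ‖a‖²/(‖ζ‖+√θ)^4`
(tree `oseenKernel` bounds, Koch–Tataru (14)), `∫₀^∞ (r_k+√θ)^{-4} dθ ~ r_k^{-2}`, shell mass `≤ 2 I r_k`
per unit time, sum `Σ_k I/r_k ≤ 4 I/‖x‖`. -/
theorem stub_radiationBound :
    ∃ c₀ : ℝ, ∀ (I B : ℝ) (M : ℝ → E³ → E³), 0 ≤ I →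
      ContinuousOn (uncurry M) (Iio (0 : ℝ) ×ˢ univ) →
      (∀ t < 0, ∀ x : E³, ‖M t x‖ ≤ B) →
      (∀ τ < 0, ∀ (z : E³) (r : ℝ), 0 < r → ∫ y in ball z r, ‖M τ y‖ ^ 2 ≤ I * r) →
      ∀ (s t : ℝ), s < t → t < 0 → ∀ x : E³, x ≠ 0 →
        ‖∫ τ in Ioo s t, ∫ y in {y : E³ | ‖x‖ / 2 ≤ ‖y - x‖},
            oseenKernel (t - τ) (x - y) (M τ y) (M τ y)‖ ≤ c₀ * I / ‖x‖ := by
  sorry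

/-! ### Stub 3 — THE BET: hull selection -/

/-- THE BET (`FarCoreDichotomy` resolved; symmetry-free form of Seregin 2014 Prop. 5.19 / KNSS 2009
(1.4) ⇒ (1.6)): granted the radiation bound, every non-trivial member `M` of the class 𝒜(C,B) has, in
its translation / zoom-in hull (`λ_k M(t_k + λ_k² s, x_k + λ_k y)`, `t_k ≤ 0`, `0 < λ_k ≤ 1`), a
slice-wise locally uniform limit `N` which is continuous on the slab, non-trivial, and obeys the KNSS
spatial bound `‖y‖ ‖N(s,y)‖ ≤ K`. The residual open content of the crux ("no self-sustained far cores /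
daughter gas"); `TaoAveragedBlowup` bites here and only here. -/
theorem stub_hullSelection :
    (∃ c₀ : ℝ, ∀ (I B : ℝ) (M : ℝ → E³ → E³), 0 ≤ I →
      ContinuousOn (uncurry M) (Iio (0 : ℝ) ×ˢ univ) →
      (∀ t < 0, ∀ x : E³, ‖M t x‖ ≤ B) →
      (∀ τ < 0, ∀ (z : E³) (r : ℝ), 0 < r → ∫ y in ball z r, ‖M τ y‖ ^ 2 ≤ I * r) →
      ∀ (s t : ℝ), s < t → t < 0 → ∀ x : E³, x ≠ 0 →
        ‖∫ τ in Ioo s t, ∫ y in {y : E³ | ‖x‖ / 2 ≤ ‖y - x‖},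
            oseenKernel (t - τ) (x - y) (M τ y) (M τ y)‖ ≤ c₀ * I / ‖x‖) →
    ∀ (C B : ℝ) (M : ℝ → E³ → E³),
      (ContinuousOn (uncurry M) (Iio (0 : ℝ) ×ˢ univ) ∧
        (∀ t < 0, IsWeaklyDivFree (M t)) ∧
        (∀ s t : ℝ, s < t → t < 0 → ∀ x : E³,
          M t x = UnboundedOperators.heatExtension (M s) (t - s) x - oseenDuhamel 1 s M M t x) ∧
        (∀ t < 0, ∀ x : E³, ‖M t x‖ ≤ B) ∧
        HasTypeITimeDecay C M ∧
        (∃ (q : ℝ → E³ → ℝ) (H : ℝ → E³ → E³ →L[ℝ] E³),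
          IsSuitableWeakSolutionOn (slab E³ (Iio 0) isOpen_Iio) 1 0 M q ∧
          HasWeakSpatialGradientOn (slab E³ (Iio 0) isOpen_Iio) M H ∧
          typeIBound (Iio (0 : ℝ) ×ˢ univ) M q H < ⊤)) →
      (∃ s : ℝ, s < 0 ∧ ∃ y : E³, M s y ≠ 0) →
      ∃ (xk : ℕ → E³) (tk : ℕ → ℝ) (lk : ℕ → ℝ) (N : ℝ → E³ → E³),
        (∀ k, tk k ≤ 0 ∧ 0 < lk k ∧ lk k ≤ 1) ∧
        (∀ t < 0, TendstoLocallyUniformly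
          (fun k (y : E³) => lk k • M (tk k + lk k ^ 2 * t) (xk k + lk k • y)) (N t) atTop) ∧
        ContinuousOn (uncurry N) (Iio (0 : ℝ) ×ˢ univ) ∧
        (∃ s : ℝ, s < 0 ∧ ∃ y : E³, N s y ≠ 0) ∧
        ∃ K : ℝ, ∀ s < 0, ∀ y : E³, ‖y‖ * ‖N s y‖ ≤ K := by
  sorry

/-! ### Stub 4 — the class is closed under hull limits -/

/-- HULL CLOSURE: a slice-wise locally uniform limit `N` (continuous on the slab) of translates /
zoom-ins `λ_k M(t_k + λ_k² ·, x_k + λ_k ·)` (`t_k ≤ 0`, `0 < λ_k ≤ 1`) of a member of 𝒜(C,B) is again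
a member of 𝒜(C,B): the bound `B` (`λ_k ≤ 1`), the rate (`t_k ≤ 0`), weak divergence-freeness and
the Oseen identity (covariance `OseenDuhamelRescale` / `oseenDuhamel_comp_sub_right`, limit passage
`tendsto_heatExtension_of_tendsto_of_bound`, `tendsto_oseenDuhamel_of_tendsto_of_bound` — step 5 of
`KNSS2009_typeI_rate_mildCompactness_holds`) pass to the limit; the suitable-weak data with `𝐈 < ⊤`
come from the engine applied to the transformed suitable triples (`zoom_isSuitableWeakSolutionOn`,
`typeIBound` invariance) and the identification `u = N` a.e. (`L³_loc` limits are unique; dominated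
convergence) with `IsSuitableWeakSolutionOn.congr_ae`, `HasWeakSpatialGradientOn.congr_ae`,
`typeIBound_congr_ae`. -/
theorem stub_hullClosed :
    (∀ (I : ℝ≥0∞) (v : ℕ → ℝ → E³ → E³) (q : ℕ → ℝ → E³ → ℝ) (G : ℕ → ℝ → E³ → E³ →L[ℝ] E³),
      I < ⊤ →
      (∀ k, IsSuitableWeakSolutionOn (slab E³ (Iio 0) isOpen_Iio) 1 0 (v k) (q k)) →
      (∀ k, HasWeakSpatialGradientOn (slab E³ (Iio 0) isOpen_Iio) (v k) (G k)) →
      (∀ k, typeIBound (Iio (0 : ℝ) ×ˢ univ) (v k) (q k) (G k) ≤ I) →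
      ∃ (u : ℝ → E³ → E³) (p : ℝ → E³ → ℝ) (H : ℝ → E³ → E³ →L[ℝ] E³) (σ : ℕ → ℕ),
        StrictMono σ ∧
        IsSuitableWeakSolutionOn (slab E³ (Iio 0) isOpen_Iio) 1 0 u p ∧
        HasWeakSpatialGradientOn (slab E³ (Iio 0) isOpen_Iio) u H ∧
        typeIBound (Iio (0 : ℝ) ×ˢ univ) u p H ≤ 4 * I ∧
        (∀ R : ℝ, 0 < R → Tendsto (fun j => eLpNorm (uncurry (v (σ j)) - uncurry u) 3
          (volume.restrict (parabolicCylinder R (0 : ℝ × E³)))) atTop (𝓝 0)) ∧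
        ((∀ R : ℝ, 0 < R → limsup (fun j => eLpNorm (uncurry (v (σ j))) ⊤
            (volume.restrict (parabolicCylinder R (0 : ℝ × E³)))) atTop = ⊤) →
          IsBackwardSingularPoint u 0)) →
    ∀ (C B : ℝ) (M : ℝ → E³ → E³) (xk : ℕ → E³) (tk : ℕ → ℝ) (lk : ℕ → ℝ) (N : ℝ → E³ → E³),
      (ContinuousOn (uncurry M) (Iio (0 : ℝ) ×ˢ univ) ∧
        (∀ t < 0, IsWeaklyDivFree (M t)) ∧
        (∀ s t : ℝ, s < t → t < 0 → ∀ x : E³,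
          M t x = UnboundedOperators.heatExtension (M s) (t - s) x - oseenDuhamel 1 s M M t x) ∧
        (∀ t < 0, ∀ x : E³, ‖M t x‖ ≤ B) ∧
        HasTypeITimeDecay C M ∧
        (∃ (q : ℝ → E³ → ℝ) (H : ℝ → E³ → E³ →L[ℝ] E³),
          IsSuitableWeakSolutionOn (slab E³ (Iio 0) isOpen_Iio) 1 0 M q ∧
          HasWeakSpatialGradientOn (slab E³ (Iio 0) isOpen_Iio) M H ∧
          typeIBound (Iio (0 : ℝ) ×ˢ univ) M q H < ⊤)) →
      (∀ k, tk k ≤ 0 ∧ 0 < lk k ∧ lk k ≤ 1) →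
      (∀ t < 0, TendstoLocallyUniformly
        (fun k (y : E³) => lk k • M (tk k + lk k ^ 2 * t) (xk k + lk k • y)) (N t) atTop) →
      ContinuousOn (uncurry N) (Iio (0 : ℝ) ×ˢ univ) →
      (ContinuousOn (uncurry N) (Iio (0 : ℝ) ×ˢ univ) ∧
        (∀ t < 0, IsWeaklyDivFree (N t)) ∧
        (∀ s t : ℝ, s < t → t < 0 → ∀ x : E³,
          N t x = UnboundedOperators.heatExtension (N s) (t - s) x - oseenDuhamel 1 s N N t x) ∧
        (∀ t < 0, ∀ x : E³, ‖N t x‖ ≤ B) ∧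
        HasTypeITimeDecay C N ∧
        (∃ (q : ℝ → E³ → ℝ) (H : ℝ → E³ → E³ →L[ℝ] E³),
          IsSuitableWeakSolutionOn (slab E³ (Iio 0) isOpen_Iio) 1 0 N q ∧
          HasWeakSpatialGradientOn (slab E³ (Iio 0) isOpen_Iio) N H ∧
          typeIBound (Iio (0 : ℝ) ×ˢ univ) N q H < ⊤)) := by
  sorry

/-! ### Stub 5 — the ⇐ transfer: blow-down of a space–time decaying solution is an apex profile -/

/-- ⇐ TRANSFER (`DecayingAncientGivesApex`, mildness not needed): a NON-trivial suitable weak slab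
solution `N` with `𝐈 < ⊤` and the shifted space–time decay `‖N(t,x)‖ ≤ C'/(1 + ‖x‖ + √(-t))` blows
DOWN to an apex profile: `v_k = nsRescale c_k N`, `c_k → ∞`, satisfy `HasTypeIDecay C'` exactly
(`c C'/(1 + c‖x‖ + c√−t) ≤ C'/(‖x‖+√−t)`), keep `𝐈` (`typeIBound_nsZoom`), and
`‖v_k‖_{L^∞(Q(0,R))} = c_k ‖N‖_{L^∞(Q(0,c_k R))} → ∞` (`tendsto_eLpNorm_top_nsZoom_atTop`); the engine
gives a singular limit with `𝐈 ≤ 4𝐈(N) < ⊤`, the decay passes to the limit a.e. (a.e.-convergent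
subsequence of an `L³_loc`-convergent one) and `exists_apex_profile_repr` picks the pointwise
representative. -/
theorem stub_apexOfDecaying :
    (∀ (I : ℝ≥0∞) (v : ℕ → ℝ → E³ → E³) (q : ℕ → ℝ → E³ → ℝ) (G : ℕ → ℝ → E³ → E³ →L[ℝ] E³),
      I < ⊤ →
      (∀ k, IsSuitableWeakSolutionOn (slab E³ (Iio 0) isOpen_Iio) 1 0 (v k) (q k)) →
      (∀ k, HasWeakSpatialGradientOn (slab E³ (Iio 0) isOpen_Iio) (v k) (G k)) →
      (∀ k, typeIBound (Iio (0 : ℝ) ×ˢ univ) (v k) (q k) (G k) ≤ I) →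
      ∃ (u : ℝ → E³ → E³) (p : ℝ → E³ → ℝ) (H : ℝ → E³ → E³ →L[ℝ] E³) (σ : ℕ → ℕ),
        StrictMono σ ∧
        IsSuitableWeakSolutionOn (slab E³ (Iio 0) isOpen_Iio) 1 0 u p ∧
        HasWeakSpatialGradientOn (slab E³ (Iio 0) isOpen_Iio) u H ∧
        typeIBound (Iio (0 : ℝ) ×ˢ univ) u p H ≤ 4 * I ∧
        (∀ R : ℝ, 0 < R → Tendsto (fun j => eLpNorm (uncurry (v (σ j)) - uncurry u) 3
          (volume.restrict (parabolicCylinder R (0 : ℝ × E³)))) atTop (𝓝 0)) ∧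
        ((∀ R : ℝ, 0 < R → limsup (fun j => eLpNorm (uncurry (v (σ j))) ⊤
            (volume.restrict (parabolicCylinder R (0 : ℝ × E³)))) atTop = ⊤) →
          IsBackwardSingularPoint u 0)) →
    (∃ (C' : ℝ) (N : ℝ → E³ → E³) (q : ℝ → E³ → ℝ) (H : ℝ → E³ → E³ →L[ℝ] E³),
      IsSuitableWeakSolutionOn (slab E³ (Iio 0) isOpen_Iio) 1 0 N q ∧
      HasWeakSpatialGradientOn (slab E³ (Iio 0) isOpen_Iio) N H ∧
      typeIBound (Iio (0 : ℝ) ×ˢ univ) N q H < ⊤ ∧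
      ¬ (uncurry N =ᵐ[volume.restrict (Iio (0 : ℝ) ×ˢ (univ : Set E³))] 0) ∧
      ∀ t : ℝ, t < 0 → ∀ x : E³, ‖N t x‖ ≤ C' / (1 + ‖x‖ + Real.sqrt (-t))) →
    ∃ (C' : ℝ) (u : ℝ → E³ → E³) (p : ℝ → E³ → ℝ) (G : ℝ → E³ → E³ →L[ℝ] E³),
      IsSuitableWeakSolutionOn (slab E³ (Iio 0) isOpen_Iio) 1 0 u p ∧
      HasWeakSpatialGradientOn (slab E³ (Iio 0) isOpen_Iio) u G ∧
      typeIBound (Iio (0 : ℝ) ×ˢ univ) u p G < ⊤ ∧ HasTypeIDecay C' u ∧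
      IsBackwardSingularPoint u 0 := by
  sorry

/-! ### Glue (proved) -/

/-- Glue: the three bounds `‖N‖ ≤ B`, `‖N‖ ≤ C/√(-t)` and `‖y‖ ‖N‖ ≤ K` combine into the shifted
space–time decay `‖N(t,y)‖ ≤ (B + C + K)/(1 + ‖y‖ + √(-t))`. -/
theorem shiftedDecay_of_bounds {N : ℝ → E³ → E³} {B C K : ℝ}
    (hB : ∀ t < 0, ∀ x : E³, ‖N t x‖ ≤ B) (hC : HasTypeITimeDecay C N)
    (hK : ∀ s < 0, ∀ y : E³, ‖y‖ * ‖N s y‖ ≤ K) :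
    ∀ t : ℝ, t < 0 → ∀ x : E³, ‖N t x‖ ≤ (B + C + K) / (1 + ‖x‖ + Real.sqrt (-t)) := by
  intro t ht x
  have hs : 0 < Real.sqrt (-t) := Real.sqrt_pos.2 (by linarith)
  have hden : 0 < 1 + ‖x‖ + Real.sqrt (-t) := by positivity
  rw [le_div_iff₀ hden]
  have h1 := hB t ht x
  have h2 : Real.sqrt (-t) * ‖N t x‖ ≤ C := by
    have := hC t ht x
    rwa [le_div_iff₀ hs, mul_comm] at this
  have h3 := hK t ht x
  nlinarith [norm_nonneg (N t x), norm_nonneg x]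

/-- Glue: a field continuous on the open slab which does not vanish at some point of the slab is not
a.e. zero there (the non-vanishing set is a non-empty open set, of positive Lebesgue measure). -/
theorem not_ae_eq_zero_of_continuousOn {N : ℝ → E³ → E³}
    (hcont : ContinuousOn (uncurry N) (Iio (0 : ℝ) ×ˢ univ)) {s : ℝ} (hs : s < 0) {y : E³}
    (hy : N s y ≠ 0) :
    ¬ (uncurry N =ᵐ[volume.restrict (Iio (0 : ℝ) ×ˢ (univ : Set E³))] 0) := by
  intro h
  have hSopen : IsOpen (Iio (0 : ℝ) ×ˢ (univ : Set E³)) := isOpen_Iio.prod isOpen_univ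
  have hUopen : IsOpen ((Iio (0 : ℝ) ×ˢ (univ : Set E³)) ∩ (uncurry N) ⁻¹' ({0}ᶜ)) :=
    hcont.isOpen_inter_preimage hSopen isOpen_compl_singleton
  have hmem : ((s, y) : ℝ × E³) ∈ (Iio (0 : ℝ) ×ˢ (univ : Set E³)) ∩ (uncurry N) ⁻¹' ({0}ᶜ) :=
    ⟨⟨hs, mem_univ _⟩, hy⟩
  have hpos : 0 < volume ((Iio (0 : ℝ) ×ˢ (univ : Set E³)) ∩ (uncurry N) ⁻¹' ({0}ᶜ)) :=
    hUopen.measure_pos volume ⟨(s, y), hmem⟩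
  have hzero : volume.restrict (Iio (0 : ℝ) ×ˢ (univ : Set E³)) ((uncurry N) ⁻¹' ({0}ᶜ)) = 0 := by
    have h' : ∀ᵐ z ∂(volume.restrict (Iio (0 : ℝ) ×ˢ (univ : Set E³))), z ∉ (uncurry N) ⁻¹' ({0}ᶜ) := by
      filter_upwards [h] with z hz
      simp [hz]
    exact measure_eq_zero_iff_ae_notMem.2 h'
  rw [Measure.restrict_apply' hSopen.measurableSet, inter_comm] at hzero
  exact hpos.ne' hzero

/-! ### Composition -/

/-- COMPOSITION of the line `decaying-ancient-bridge`: the six stubs imply the crux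
`RellichScar.ApexLocalisation` (by name). -/
theorem ApexLocalisation_of :
    Summit.NavierStokesRegularity.NavierStokesRegularity.Theses.RellichScar.ApexLocalisation := by
  intro C hRate
  -- ⇒ transfer: a non-trivial bounded decaying ancient solution of the class 𝒜(C,B)
  obtain ⟨B, M, hM, hMnt⟩ := stub_rateToAncient stub_slabCompactness C hRate
  -- the bet: a hull limit with the KNSS spatial bound
  obtain ⟨xk, tk, lk, N, hadm, hconv, hNcont, hNnt, K, hK⟩ :=
    stub_hullSelection stub_radiationBound C B M hM hMnt
  -- hull closure: the limit is again in the class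
  obtain ⟨-, -, -, hNB, hNC, q, H, hsws, hgrad, hI⟩ :=
    stub_hullClosed stub_slabCompactness C B M xk tk lk N hM hadm hconv hNcont
  -- glue: shifted space–time decay and a.e.-non-triviality
  have hdecay := shiftedDecay_of_bounds hNB hNC hK
  obtain ⟨s, hs, y, hy⟩ := hNnt
  have hnt := not_ae_eq_zero_of_continuousOn hNcont hs hy
  -- ⇐ transfer: blow down to an apex profile
  exact stub_apexOfDecaying stub_slabCompactness ⟨B + C + K, N, q, H, hsws, hgrad, hI, hnt, hdecay⟩

end Summit.NavierStokesRegularity.NavierStokesRegularity.Theorems.RellichScarApexLocalisation
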